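import Literature.AlgebraicGeometry.Modules.GrothendieckComplexKernelRepr
import Literature.Algebra.Module.TwoTermComplexBaseChange
import HarnessLib

/-!
# Semicontinuity of `h⁰` and cohomology and base change in degree `0` for a line bundle on `P ×_K T`
# (Mumford, *Abelian Varieties*, §5 Cor. 1–2; Görtz–Wedhorn II, Thm. 23.139 (2), Cor. 23.135)

Topic `AlgebraicGeometry/Modules`; namespace `Literature.AlgebraicGeometry.Modules`; a *proofs* file
(theorems only). ★ `Modules/GrothendieckComplexKernelRepr` attaches to a rank-one module `L` on
`P ×_K T` (`P → Spec K` proper geometrically integral, `T` affine with noetherian ring `A = Γ(T, 𝒪_T)`,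
`𝓥` a finite affine cover with affine intersections) its GROTHENDIECK COMPLEX `K•` — finite projective
`A`-modules with `Γ(P ×_K T', g^*L) ≃ₗ[B'] ker(d⁰ ⊗_A B')` for every affine test object `j : T' → T`,
`B' = Γ(T', 𝒪)` (`Modules.kernelReprEquiv`). ★ `Algebra/Module/TwoTermComplexBaseChange` is the linear
algebra of Mumford's §5 for `d⁰ : K⁰ → K¹`. This file composes the two:

* **`isClosed_setOf_le_finrank_ker_grothendieck`** — upper semicontinuity of
  `h⁰(𝔭) = dim_{κ(𝔭)} ker(d⁰ ⊗ κ(𝔭))` (= `dim H⁰(X_𝔭, L_𝔭)` by `kernelReprEquiv` at the point `Spec κ(𝔭) → T`)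
  on `Spec A` (Mumford §5 Cor. 1; Görtz–Wedhorn II, Thm. 23.139 (2)), and the open form;
* **`nonempty_secMod_equiv_baseChange_ker_of_finrank_ker_eq`** — cohomology and base change in degree `0`
  (Mumford §5 Cor. 2): if `T` is moreover INTEGRAL (`A` a domain) and `h⁰` is constant on `Spec A`, then
  `ker d⁰` (the model of `π_*L`) is finite projective and for every affine test object
  `Γ(P ×_K T', g^*L) ≃ₗ[B'] B' ⊗_A ker d⁰` — «`π_*L` is locally free and commutes with arbitrary base change»;
* `nonempty_secMod_equiv_baseChange_ker_of_projective` — the same conclusion over ANY affine noetherian `T`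
  from projectivity of the representing module `Q = (K⁰)^∨ ⧸ im (d⁰)^∨` (EGA III 7.8.4), the form used over
  non-reduced (e.g. Artinian) bases.

Everything is proved; no named facts. NOT here: the identification of `PrimeSpectrum Γ(T, 𝒪_T)` with the
points of `T` and of `κ(𝔭)`-test objects with scheme-theoretic fibres (so `h⁰` is stated on `Spec A`), and
the comparison of the base-change isomorphism with the canonical map `b ⊗ s ↦ b · g^*s`.
Cell `hodgecm-mathlib`, SOCKETS-F §3 node N-bc (B-plan1 (g13)); count-neutral; B-p10 (g9).

## References

* D. Mumford, *Abelian Varieties*, TIFR Studies in Mathematics 5 (1970), §5, Cor. 1 and Cor. 2 (p. 50).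
  [MumfordAV1970]
* U. Görtz, T. Wedhorn, *Algebraic Geometry II: Cohomology of Schemes* (2023), Cor. 23.135 (p. 355),
  Thm. 23.139 (2). [GortzWedhorn2023]
* R. Hartshorne, *Algebraic Geometry*, GTM 52 (1977), III Cor. 12.9, Prop. 12.11. [Hartshorne1977]
-/

universe u

open CategoryTheory CategoryTheory.Limits AlgebraicGeometry TopologicalSpace Opposite MonoidalCategory
open CartesianMonoidalCategory TensorProduct
open Literature.AlgebraicGeometry.Motives Literature.Algebra.Homology Literature.Algebra.Module

set_option backward.isDefEq.respectTransparency false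

noncomputable section

namespace Literature.AlgebraicGeometry.Modules

section BaseChange

variable {K : Type u} [Field K] (P T : SchemeOver K) [IsAffine T.left]
variable {ι : Type} [LinearOrder ι] [Fintype ι] (𝓥 : ι → (P ⊗ T).left.Opens) (L : (P ⊗ T).left.Modules)
variable (hV : ∀ s : Finset ι, s.Nonempty → IsAffineOpen (cechOpen 𝓥 s)) (hcov : ⨆ i, 𝓥 i = ⊤)
variable [IsProper P.hom] [GeometricallyIntegral P.hom] [Flat P.hom] [UniversallyOpen P.hom]
  [IsNoetherianRing Γ(T.left, ⊤)] [IsLocallyNoetherian T.left] (hL : HasRank L 1)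

/-- The terms of the Grothendieck complex are finite `A`-modules. [cite: GortzWedhorn2023, Cor. 23.135 (p. 355)] -/
theorem finite_grothendieckComplex_X (n : ℤ) :
    Module.Finite Γ(T.left, ⊤) ((grothendieckComplex P T 𝓥 L hV hcov hL).X n) :=
  ((grothendieckComplex_spec P T 𝓥 L hV hcov hL).2.2.2 n).1

/-- The terms of the Grothendieck complex are projective `A`-modules. [cite: GortzWedhorn2023, Cor. 23.135 (p. 355)] -/
theorem projective_grothendieckComplex_X (n : ℤ) :
    Module.Projective Γ(T.left, ⊤) ((grothendieckComplex P T 𝓥 L hV hcov hL).X n) :=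
  ((grothendieckComplex_spec P T 𝓥 L hV hcov hL).2.2.2 n).2

/-- **Upper semicontinuity of `h⁰`** (Mumford, *Abelian Varieties*, §5 Cor. 1; Görtz–Wedhorn II,
Thm. 23.139 (2)): for every `n`, the set of primes `𝔭` of `A = Γ(T, 𝒪_T)` with
`n ≤ dim_{κ(𝔭)} ker(d⁰ ⊗_A κ(𝔭))` — by `kernelReprEquiv` at the test object `Spec κ(𝔭) → T` this is
`n ≤ dim H⁰(P ×_K Spec κ(𝔭), L|)` — is CLOSED in `Spec A`. [cite: MumfordAV1970, §5 Cor. 1 (p. 50)]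
[cite: GortzWedhorn2023, Thm. 23.139 (2)] -/
theorem isClosed_setOf_le_finrank_ker_grothendieck (n : ℕ) :
    IsClosed {p : PrimeSpectrum Γ(T.left, ⊤) | n ≤ Module.finrank p.asIdeal.ResidueField
      (LinearMap.ker (((grothendieckComplex P T 𝓥 L hV hcov hL).d 0 1).hom.baseChange
        p.asIdeal.ResidueField))} := by
  haveI := finite_grothendieckComplex_X P T 𝓥 L hV hcov hL 0
  haveI := finite_grothendieckComplex_X P T 𝓥 L hV hcov hL 1
  haveI := projective_grothendieckComplex_X P T 𝓥 L hV hcov hL 0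
  haveI := projective_grothendieckComplex_X P T 𝓥 L hV hcov hL 1
  exact isClosed_setOf_le_finrank_ker_baseChange _ n

/-- The open form of semicontinuity: `{𝔭 ; dim ker(d⁰ ⊗ κ(𝔭)) < n}` is open. [cite: MumfordAV1970, §5 Cor. 1 (p. 50)] -/
theorem isOpen_setOf_finrank_ker_grothendieck_lt (n : ℕ) :
    IsOpen {p : PrimeSpectrum Γ(T.left, ⊤) | Module.finrank p.asIdeal.ResidueField
      (LinearMap.ker (((grothendieckComplex P T 𝓥 L hV hcov hL).d 0 1).hom.baseChange
        p.asIdeal.ResidueField)) < n} := by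
  haveI := finite_grothendieckComplex_X P T 𝓥 L hV hcov hL 0
  haveI := finite_grothendieckComplex_X P T 𝓥 L hV hcov hL 1
  haveI := projective_grothendieckComplex_X P T 𝓥 L hV hcov hL 0
  haveI := projective_grothendieckComplex_X P T 𝓥 L hV hcov hL 1
  exact isOpen_setOf_finrank_ker_baseChange_lt _ n

variable {T' : SchemeOver K} [IsAffine T'.left] (j : T' ⟶ T)

/-- **Cohomology and base change in degree `0` from projectivity of `Q`** (EGA III 7.8.4; Mumford §5 Cor. 2
«⇐»): if the module `Q = (K⁰)^∨ ⧸ im (d⁰)^∨` representing `B ↦ ker(d⁰ ⊗ B)` is projective, then `ker d⁰` is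
finite projective and `Γ(P ×_K T', g^*L) ≃ₗ[B'] B' ⊗_A ker d⁰` on every affine test object — over ANY affine
noetherian base, reduced or not. [cite: MumfordAV1970, §5 Cor. 2 (p. 50)] -/
theorem nonempty_secMod_equiv_baseChange_ker_of_projective
    [Module.Projective Γ(T.left, ⊤) (Module.Dual Γ(T.left, ⊤) ((grothendieckComplex P T 𝓥 L hV hcov hL).X 0) ⧸
      LinearMap.range ((grothendieckComplex P T 𝓥 L hV hcov hL).d 0 1).hom.dualMap)] :
    letI := testAlgebra T j
    (Module.Finite Γ(T.left, ⊤) (LinearMap.ker ((grothendieckComplex P T 𝓥 L hV hcov hL).d 0 1).hom) ∧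
      Module.Projective Γ(T.left, ⊤) (LinearMap.ker ((grothendieckComplex P T 𝓥 L hV hcov hL).d 0 1).hom)) ∧
    Nonempty (SecMod (testMod P T j L) (baseToTotal P T') ⊤ ≃ₗ[Γ(T'.left, ⊤)]
      Γ(T'.left, ⊤) ⊗[Γ(T.left, ⊤)] LinearMap.ker ((grothendieckComplex P T 𝓥 L hV hcov hL).d 0 1).hom) := by
  letI := testAlgebra T j
  haveI := finite_grothendieckComplex_X P T 𝓥 L hV hcov hL 0
  haveI := finite_grothendieckComplex_X P T 𝓥 L hV hcov hL 1
  haveI := projective_grothendieckComplex_X P T 𝓥 L hV hcov hL 0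
  haveI := projective_grothendieckComplex_X P T 𝓥 L hV hcov hL 1
  obtain ⟨e⟩ := nonempty_baseChange_kerEquiv_of_projective
    ((grothendieckComplex P T 𝓥 L hV hcov hL).d 0 1).hom Γ(T'.left, ⊤)
  exact ⟨finite_projective_ker_of_projective _, ⟨(kernelReprEquiv P T 𝓥 L hV hcov hL j).trans e.symm⟩⟩

/-- **Cohomology and base change in degree `0` over an integral base** (Mumford, *Abelian Varieties*, §5
Cor. 2; Hartshorne III, Cor. 12.9): if `A = Γ(T, 𝒪_T)` is a DOMAIN and `𝔭 ↦ dim_{κ(𝔭)} ker(d⁰ ⊗ κ(𝔭))`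
(`= dim H⁰(X_𝔭, L_𝔭)`) is CONSTANT on `Spec A`, then `ker d⁰` — the model of `π_*L` — is finite projective and
`Γ(P ×_K T', g^*L) ≃ₗ[B'] B' ⊗_A ker d⁰` for every affine test object `j : T' → T`: «`π_*L` is locally free and
its formation commutes with arbitrary base change». [cite: MumfordAV1970, §5 Cor. 2 (p. 50)]
[cite: Hartshorne1977, III Cor. 12.9] -/
theorem nonempty_secMod_equiv_baseChange_ker_of_finrank_ker_eq [IsDomain Γ(T.left, ⊤)] (r : ℕ)
    (h : ∀ p : PrimeSpectrum Γ(T.left, ⊤), Module.finrank p.asIdeal.ResidueField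
      (LinearMap.ker (((grothendieckComplex P T 𝓥 L hV hcov hL).d 0 1).hom.baseChange
        p.asIdeal.ResidueField)) = r) :
    letI := testAlgebra T j
    (Module.Finite Γ(T.left, ⊤) (LinearMap.ker ((grothendieckComplex P T 𝓥 L hV hcov hL).d 0 1).hom) ∧
      Module.Projective Γ(T.left, ⊤) (LinearMap.ker ((grothendieckComplex P T 𝓥 L hV hcov hL).d 0 1).hom)) ∧
    Nonempty (SecMod (testMod P T j L) (baseToTotal P T') ⊤ ≃ₗ[Γ(T'.left, ⊤)]
      Γ(T'.left, ⊤) ⊗[Γ(T.left, ⊤)] LinearMap.ker ((grothendieckComplex P T 𝓥 L hV hcov hL).d 0 1).hom) := by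
  haveI := finite_grothendieckComplex_X P T 𝓥 L hV hcov hL 0
  haveI := finite_grothendieckComplex_X P T 𝓥 L hV hcov hL 1
  haveI := projective_grothendieckComplex_X P T 𝓥 L hV hcov hL 0
  haveI := projective_grothendieckComplex_X P T 𝓥 L hV hcov hL 1
  haveI := projective_quotient_dual_of_finrank_ker_baseChange_eq
    ((grothendieckComplex P T 𝓥 L hV hcov hL).d 0 1).hom r h
  exact nonempty_secMod_equiv_baseChange_ker_of_projective P T 𝓥 L hV hcov hL j

end BaseChange

end Literature.AlgebraicGeometry.Modules

end
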